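import Summits.ResolutionOfSingularities.ResolutionOfSingularities.Theorems.PurelyInseparableDim4ResConePowerCone
import HarnessLib
import HarnessLib.Audit.Tags

/-!
# Purely inseparable four-folds — THE POLAR KERNEL SPLITS OFF THE `p`-TH POWERS: for `g = G + Σᵢ xᵢ^p Hᵢ`
# with `G`, `Hᵢ` TAME (all exponents `< p`), `A(g) = A(G) ∩ ⋂ᵢ A(Hᵢ)` (every prime; the structure of the
# wild-shade slice A of K2(p))

[OURS · counted 0 · cell `res-dim4-pi` · seat res-dim4-p-12 g2 · K2(p) lane (desk WORD #66 (2)).]  Nothing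
here proves K2(p), `NoIsolatedTrap p p` or resolution of singularities in dimension ≥ 4 / characteristic `p`.

In the wild-shade slice `p ≤ d ≤ (3p − 4)/2 < 2p` of the located residue (`…ResConeSlices`) every monomial of
the residual cone has AT MOST ONE exponent `≥ p`, so `g = G + Σᵢ xᵢ^p · Hᵢ` with `G` and the `Hᵢ` tame
(exponents `< p`; `deg Hᵢ = d − p < p/2`).  Since `∂_k (xᵢ^p) = 0` (`pderiv_X_pow_charP`), polars respect the
splitting (`polarMap_add_sum_X_pow_mul`: `D_w g = D_w G + Σᵢ xᵢ^p D_w Hᵢ`) and tame polars never collide with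
the `xᵢ^p`-shifted ones (`coeff` bookkeeping), whence **`mem_additiveSubspace_add_sum_X_pow_mul_iff`**:
`w ∈ A(G + Σ xᵢ^p Hᵢ) ⟺ w ∈ A(G) ∧ ∀ i, w ∈ A(Hᵢ)`.  Consequences for slice A: `e_G = dim (A(G) ∩ ⋂ A(Hᵢ))`;
`e_G = 4 ⟺ G` and all `Hᵢ` have vanishing polars (at `d = p`: `Hᵢ` constants, `G = 0`, cf. `…VertexTop`).
bears_on: LADDER-RESOLUTION:D157-DOOR2 (res-dim4-pi · K2(p) slice A).  Supports
stmt-ResolutionOfSingularities-16155 (helper).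
-/

set_option linter.dupNamespace false -- mandated namespace of this single-conjunct summit

noncomputable section

namespace Summit.ResolutionOfSingularities.ResolutionOfSingularities.Theorems.PIDim4

namespace ResCone

open MvPolynomial Finset
open Literature.AlgebraicGeometry.Resolution
open Literature.AlgebraicGeometry.Resolution.CentreBlowup
open Literature.AlgebraicGeometry.Resolution.Hauser2010
open Literature.AlgebraicGeometry.Resolution.HauserPerlega2019
open PointBlowup (polarMap additiveSubspace direction)

variable {K : Type} [Field K]

/-! ## 1. Polars do not see `p`-th powers -/

/-- `∂_k (x_i^p) = 0` in characteristic `p` (any `k`). [folklore] -/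
theorem pderiv_X_pow_charP (p : ℕ) [Fact p.Prime] [CharP K p] (k i : Fin 4) :
    pderiv k ((X i : MvPolynomial (Fin 4) K) ^ p) = 0 := by
  rw [(pderiv k).leibniz_pow, nsmul_eq_mul]
  have : ((p : ℕ) : MvPolynomial (Fin 4) K) = 0 := by
    rw [← map_natCast (C : K →+* MvPolynomial (Fin 4) K), CharP.cast_eq_zero, map_zero]
  rw [this, zero_mul]

/-- **Polars respect the `p`-th power splitting**: `D_w (G + Σ xᵢ^p Hᵢ) = D_w G + Σ xᵢ^p · D_w Hᵢ`.
[folklore] -/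
theorem polarMap_add_sum_X_pow_mul (p : ℕ) [Fact p.Prime] [CharP K p] (G : MvPolynomial (Fin 4) K)
    (H : Fin 4 → MvPolynomial (Fin 4) K) (w : Fin 4 → K) :
    polarMap (G + ∑ i, (X i : MvPolynomial (Fin 4) K) ^ p * H i) w =
      polarMap G w + ∑ i, (X i : MvPolynomial (Fin 4) K) ^ p * polarMap (H i) w := by
  have hleib : ∀ k i, pderiv k ((X i : MvPolynomial (Fin 4) K) ^ p * H i) =
      (X i : MvPolynomial (Fin 4) K) ^ p * pderiv k (H i) := by
    intro k i
    rw [(pderiv k).leibniz, pderiv_X_pow_charP p k i, smul_zero, add_zero, smul_eq_mul]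
  have hk : ∀ k, pderiv k (G + ∑ i, (X i : MvPolynomial (Fin 4) K) ^ p * H i) =
      pderiv k G + ∑ i, (X i : MvPolynomial (Fin 4) K) ^ p * pderiv k (H i) := by
    intro k
    rw [map_add, map_sum]
    exact congrArg _ (Finset.sum_congr rfl fun i _ => hleib k i)
  have hR : ∀ i, (X i : MvPolynomial (Fin 4) K) ^ p * polarMap (H i) w =
      ∑ k, C (w k) * ((X i : MvPolynomial (Fin 4) K) ^ p * pderiv k (H i)) := by
    intro i
    rw [polarMap_eq_sum_C_mul, Finset.mul_sum]
    exact Finset.sum_congr rfl fun k _ => mul_left_comm _ _ _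
  rw [polarMap_eq_sum_C_mul, polarMap_eq_sum_C_mul]
  simp_rw [hk, hR, mul_add, Finset.sum_add_distrib, Finset.mul_sum]
  exact congrArg _ Finset.sum_comm

/-! ## 2. Tame polynomials: exponents `< p` -/

/-- A polar of a tame polynomial is tame: its monomials have all exponents `< p`. [folklore] -/
theorem apply_lt_of_mem_support_polarMap {p : ℕ} {Φ : MvPolynomial (Fin 4) K}
    (hΦ : ∀ e ∈ Φ.support, ∀ k, e k < p) (w : Fin 4 → K) {e : Fin 4 →₀ ℕ}
    (he : e ∈ (polarMap Φ w).support) (k : Fin 4) : e k < p := by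
  by_contra hge
  apply MvPolynomial.mem_support_iff.mp he
  rw [NarrowApolarity.coeff_polarMap]
  refine Finset.sum_eq_zero fun j _ => ?_
  have hnot : e + Finsupp.single j 1 ∉ Φ.support := by
    intro hmem
    have h := hΦ _ hmem k
    rw [Finsupp.add_apply] at h
    omega
  rw [MvPolynomial.notMem_support_iff.mp hnot, zero_mul, mul_zero]

/-- Coefficients of `xᵢ^p · Q`: shift by `p · eᵢ`. [folklore] -/
theorem coeff_X_pow_mul_eq (p : ℕ) (i : Fin 4) (Q : MvPolynomial (Fin 4) K) (e : Fin 4 →₀ ℕ) :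
    coeff e ((X i : MvPolynomial (Fin 4) K) ^ p * Q) =
      if p ≤ e i then coeff (e - Finsupp.single i p) Q else 0 := by
  rw [X_pow_eq_monomial, coeff_monomial_mul', one_mul]
  simp only [Finsupp.single_le_iff]

/-! ## 3. The splitting of the polar kernel -/

/-- **THE POLAR KERNEL SPLITS OFF THE `p`-TH POWERS**: for tame `G` and tame `Hᵢ`,
`w ∈ A(G + Σᵢ xᵢ^p Hᵢ) ⟺ w ∈ A(G) ∧ ∀ i, w ∈ A(Hᵢ)`. [OURS] [folklore] -/
theorem mem_additiveSubspace_add_sum_X_pow_mul_iff (p : ℕ) [Fact p.Prime] [CharP K p]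
    {G : MvPolynomial (Fin 4) K} {H : Fin 4 → MvPolynomial (Fin 4) K}
    (hG : ∀ e ∈ G.support, ∀ k, e k < p) (hH : ∀ i, ∀ e ∈ (H i).support, ∀ k, e k < p)
    (w : Fin 4 → K) :
    w ∈ additiveSubspace (G + ∑ i, (X i : MvPolynomial (Fin 4) K) ^ p * H i) ↔
      w ∈ additiveSubspace G ∧ ∀ i, w ∈ additiveSubspace (H i) := by
  unfold additiveSubspace
  simp only [LinearMap.mem_ker]
  rw [polarMap_add_sum_X_pow_mul p G H w]
  constructor
  · intro hsum
    -- Step 1: the tame part vanishes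
    have hP : polarMap G w = 0 := by
      ext e
      rw [coeff_zero]
      by_cases htame : ∀ k, e k < p
      · have h := congrArg (coeff e) hsum
        rw [coeff_add, coeff_zero, coeff_sum, Finset.sum_eq_zero fun i _ => ?_, add_zero] at h
        · exact h
        · rw [coeff_X_pow_mul_eq, if_neg (by have := htame i; omega)]
      · push Not at htame
        obtain ⟨k, hk⟩ := htame
        exact MvPolynomial.notMem_support_iff.mp fun hmem =>
          absurd (apply_lt_of_mem_support_polarMap hG w hmem k) (by omega)
    refine ⟨hP, fun i => ?_⟩
    rw [hP, zero_add] at hsum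
    -- Step 2: each shifted part vanishes
    ext f
    rw [coeff_zero]
    by_cases htame : ∀ k, f k < p
    · have h := congrArg (coeff (f + Finsupp.single i p)) hsum
      rw [coeff_zero, coeff_sum, Finset.sum_eq_single i (fun k _ hki => ?_)
        (fun h => absurd (Finset.mem_univ _) h), coeff_X_pow_mul_eq, if_pos (by simp),
        add_tsub_cancel_right] at h
      · exact h
      · rw [coeff_X_pow_mul_eq, if_neg]
        rw [Finsupp.add_apply, Finsupp.single_eq_of_ne hki]
        have := htame k
        omega
    · push Not at htame
      obtain ⟨k, hk⟩ := htame
      exact MvPolynomial.notMem_support_iff.mp fun hmem =>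
        absurd (apply_lt_of_mem_support_polarMap (hH i) w hmem k) (by omega)
  · rintro ⟨hP, hQ⟩
    rw [hP, zero_add]
    exact Finset.sum_eq_zero fun i _ => by rw [hQ i, mul_zero]

/-- **Rank form**: for tame `G`, `Hᵢ` the polar kernel of `G + Σ xᵢ^p Hᵢ` is the intersection of the five
tame polar kernels. [OURS] [folklore] -/
theorem additiveSubspace_add_sum_X_pow_mul_eq (p : ℕ) [Fact p.Prime] [CharP K p]
    {G : MvPolynomial (Fin 4) K} {H : Fin 4 → MvPolynomial (Fin 4) K}
    (hG : ∀ e ∈ G.support, ∀ k, e k < p) (hH : ∀ i, ∀ e ∈ (H i).support, ∀ k, e k < p) :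
    additiveSubspace (G + ∑ i, (X i : MvPolynomial (Fin 4) K) ^ p * H i) =
      additiveSubspace G ⊓ ⨅ i, additiveSubspace (H i) := by
  ext w
  rw [mem_additiveSubspace_add_sum_X_pow_mul_iff p hG hH, Submodule.mem_inf, Submodule.mem_iInf]

end ResCone

end Summit.ResolutionOfSingularities.ResolutionOfSingularities.Theorems.PIDim4

end
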